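import Summits.Ventures.PercRepro.RankLevelSetHCore

/-!
# PercRepro — C-025 at `(6,4)` under the hard max-trace rule: the exact counting identities (p3, gen 8)

mine-2's `MINE2-RLS.md` §21.0 / §21.8 (lead ruling 17:39:56Z): for a solid `G` (a rank-`4` flat) the single-point
witnesses `S = B′ ∪ {x}` of a rank-`4` set `B′ ⊆ G` give `G` the hard max-trace weight `w_∞(B′) = 1/(1 + m(B′))`,
where `m(B′)` counts the hyperplanes of `M|S` of maximal trace other than `B′` itself — equivalently the COLOOPS
of the restriction `M|B′` (the apexes of the `(|B′| − 1)`-traces; §21.0 «there are `1 + m(B′)` coloops»).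
The per-solid balance at `t` is
`J_t(G) := Σ_{B′ ∈ R₄(G)} (6 − t)·w_∞(B′) − (6/5)·(N₄ − DF_t)`, with `N₄ = |R₄(G)|` and `DF_t` the demand-free sets
(`r(G ∖ B′) ≤ t − 1`).  This file is the reusable core of §21.8:

* `R4 M G`, `coloopsOf M B`, `mTr M B` (`= m(B′)`), `wInf M B` (`= w_∞(B′)`), the counts `N4`, `I4` (independent
  `4`-sets), `pp` (`m = 1`), `lpp` (`m = 2`), `DF M G t`, and the balance `J M G t`;
* Lemma 21.1 in the coloop form: an independent `4`-set has `m = 4` (`mTr_eq_four_of_card_eq_four`) and, in a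
  SIMPLE matroid, a rank-`4` set with `≥ 5` points has `m ≤ 2` (`mTr_le_two_of_five_le`: three coloops would leave
  a rank-`1` set with two points);
* the four-kind decomposition `1 − w_∞ = 4/5, 1/2, 2/3, 0` (`one_sub_wInf_eq`) and the summed form
  `Σ w_∞ = N₄ − (4/5)·I₄ − (1/2)·pp − (2/3)·lpp` (`sum_wInf_eq`);
* the EXACT identities `J_t = (6 − t)·(N₄ − (4/5)I₄ − (1/2)pp − (2/3)lpp) − (6/5)(N₄ − DF_t)` (`J_eq`), in particular
  `J₄ = (4/5)N₄ + (6/5)DF₄ − (8/5)I₄ − pp − (4/3)lpp` (`J_four_eq`) and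
  `J₃ = (9/5)N₄ + (6/5)DF₃ − (12/5)I₄ − (3/2)pp − 2·lpp` (`J_three_eq`).

No solid hypothesis is needed for the identities themselves: `G` is any subset of a simple finite matroid's ground
set.  Imports `RankLevelSetHCore` (`Simple`, `gr`, `clF`, `two_le_eRk_of_two_mem`) only.
-/

namespace PercRepro.SixFour

open Finset ThmH

variable {α : Type*} [DecidableEq α] {M : Matroid α} [M.Finite]

/-! ## The objects: rank-`4` subsets, coloops of `M|B′`, `m(B′)`, `w_∞(B′)` -/

/-- The rank-`4` subsets of `G` (`R₄(G)` of mine-2 §21.0). -/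
noncomputable def R4 (M : Matroid α) [M.Finite] (G : Finset α) : Finset (Finset α) :=
  G.powerset.filter (fun B : Finset α => M.eRk ((B : Finset α) : Set α) = 4)

omit [DecidableEq α] in
/-- Membership in `R4`. -/
theorem mem_R4 {G B : Finset α} : B ∈ R4 M G ↔ B ⊆ G ∧ M.eRk (B : Set α) = 4 := by
  unfold R4
  simp only [Finset.mem_filter, Finset.mem_powerset]

/-- The coloops of the restriction `M|B`: the points of `B` outside the closure of the other points of `B`. -/
noncomputable def coloopsOf (M : Matroid α) [M.Finite] (B : Finset α) : Finset α :=
  B.filter (fun x => x ∉ clF M (B.erase x))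

omit [DecidableEq α] in
/-- Membership in `clF`. -/
theorem mem_clF {B : Finset α} {x : α} : x ∈ clF M B ↔ x ∈ M.closure (B : Set α) := by
  rw [← Finset.mem_coe, coe_clF]

/-- Membership in `coloopsOf`. -/
theorem mem_coloopsOf {B : Finset α} {x : α} :
    x ∈ coloopsOf M B ↔ x ∈ B ∧ x ∉ M.closure ((B.erase x : Finset α) : Set α) := by
  unfold coloopsOf
  rw [Finset.mem_filter, mem_clF]

/-- `m(B′)`: the number of coloops of `M|B′` (= the number of hyperplanes of `M|(B′ ∪ {x})` of maximal trace
other than `B′`, mine-2 §21.0). -/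
noncomputable def mTr (M : Matroid α) [M.Finite] (B : Finset α) : ℕ := (coloopsOf M B).card

/-- `w_∞(B′) = 1/(1 + m(B′))`, the hard max-trace weight of the solid `G ⊇ B′` at a single-point witness. -/
noncomputable def wInf (M : Matroid α) [M.Finite] (B : Finset α) : ℚ := 1 / (1 + (mTr M B : ℚ))

/-- The weight is positive. -/
theorem wInf_pos (B : Finset α) : 0 < wInf M B := by
  unfold wInf
  positivity

/-- The weight is at most `1`. -/
theorem wInf_le_one (B : Finset α) : wInf M B ≤ 1 := by
  unfold wInf
  rw [div_le_one (by positivity)]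
  linarith [(Nat.cast_nonneg (mTr M B) : (0 : ℚ) ≤ mTr M B)]

/-! ## The counts of §21.8 and the balance `J_t` -/

/-- `N₄(G) = |R₄(G)|`. -/
noncomputable def N4 (M : Matroid α) [M.Finite] (G : Finset α) : ℕ := (R4 M G).card

/-- `I₄(G)`: the independent `4`-subsets of `G` (the rank-`4` sets with `4` points). -/
noncomputable def I4 (M : Matroid α) [M.Finite] (G : Finset α) : ℕ :=
  ((R4 M G).filter (fun B : Finset α => B.card = 4)).card

/-- `pp(G)`: the rank-`4` subsets with exactly one coloop (`m = 1`: plane + point sets with a unique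
`(b − 1)`-trace). -/
noncomputable def pp (M : Matroid α) [M.Finite] (G : Finset α) : ℕ :=
  ((R4 M G).filter (fun B : Finset α => mTr M B = 1)).card

/-- `lpp(G)`: the rank-`4` subsets with exactly two coloops (`m = 2`). -/
noncomputable def lpp (M : Matroid α) [M.Finite] (G : Finset α) : ℕ :=
  ((R4 M G).filter (fun B : Finset α => mTr M B = 2)).card

/-- `DF_t(G)`: the demand-free rank-`4` subsets, `r(G ∖ B′) ≤ t − 1` (stated as `r(G ∖ B′) + 1 ≤ t`). -/
noncomputable def DF (M : Matroid α) [M.Finite] (G : Finset α) (t : ℕ) : ℕ :=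
  ((R4 M G).filter (fun B : Finset α => M.eRk ((G \ B : Finset α) : Set α) + 1 ≤ (t : ℕ∞))).card

/-- The per-solid balance `J_t(G) = Σ_{B′ ∈ R₄(G)} (6 − t)·w_∞(B′) − (6/5)·(N₄ − DF_t)` (mine-2 §21.8). -/
noncomputable def J (M : Matroid α) [M.Finite] (G : Finset α) (t : ℕ) : ℚ :=
  (∑ B ∈ R4 M G, ((6 : ℚ) - t) * wInf M B) - (6 / 5 : ℚ) * ((N4 M G : ℚ) - (DF M G t : ℚ))

/-! ## Lemma 21.1 in the coloop form -/

omit [DecidableEq α] [M.Finite] in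
/-- A rank-`4` set has at least `4` points. -/
theorem four_le_card_of_eRk_eq_four {B : Finset α} (hr : M.eRk (B : Set α) = 4) : 4 ≤ B.card := by
  have h := M.eRk_le_encard (B : Set α)
  rw [hr, Set.encard_coe_eq_coe_finsetCard] at h
  exact_mod_cast h

omit [DecidableEq α] [M.Finite] in
/-- A rank-`4` set with `4` points is independent. -/
theorem indep_of_eRk_eq_four_of_card_eq_four {B : Finset α} (hr : M.eRk (B : Set α) = 4)
    (hc : B.card = 4) : M.Indep (B : Set α) := by
  rw [Matroid.indep_iff_eRk_eq_encard_of_finite (Finset.finite_toSet B), hr,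
    Set.encard_coe_eq_coe_finsetCard, hc]
  rfl

/-- Every point of an independent `4`-set (of rank `4`) is a coloop of its restriction. -/
theorem coloopsOf_eq_self_of_card_eq_four {B : Finset α} (hr : M.eRk (B : Set α) = 4) (hc : B.card = 4) :
    coloopsOf M B = B := by
  have hI := indep_of_eRk_eq_four_of_card_eq_four hr hc
  ext x
  rw [mem_coloopsOf]
  constructor
  · exact fun h => h.1
  · intro hx
    refine ⟨hx, ?_⟩
    rw [Finset.coe_erase]
    exact hI.notMem_closure_sdiff_of_mem hx

/-- `m(B′) = 4` for an independent `4`-set. -/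
theorem mTr_eq_four_of_card_eq_four {B : Finset α} (hr : M.eRk (B : Set α) = 4) (hc : B.card = 4) :
    mTr M B = 4 := by
  unfold mTr
  rw [coloopsOf_eq_self_of_card_eq_four hr hc, hc]

/-- Removing a point outside the closure of the rest drops the rank by exactly one. -/
theorem eRk_erase_add_one_of_notMem_closure {B : Finset α} (hB : B ⊆ gr M) {x : α} (hx : x ∈ B)
    (hcl : x ∉ M.closure ((B.erase x : Finset α) : Set α)) :
    M.eRk ((B.erase x : Finset α) : Set α) + 1 = M.eRk (B : Set α) := by
  have hxE : x ∈ M.E := by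
    rw [← coe_gr M]
    exact Finset.mem_coe.2 (hB hx)
  have h := Matroid.eRk_insert_eq_add_one (M := M) (e := x) (X := ((B.erase x : Finset α) : Set α)) ⟨hxE, hcl⟩
  rw [← h]
  congr 1
  rw [← Finset.coe_insert, Finset.insert_erase hx]

/-- A coloop of `M|B` stays a coloop of `M|B′` for every `B′ ⊆ B` containing it (closures are monotone). -/
theorem mem_coloopsOf_of_subset {B B' : Finset α} (hB' : B' ⊆ B) {x : α} (hx : x ∈ B')
    (h : x ∈ coloopsOf M B) : x ∈ coloopsOf M B' := by
  rw [mem_coloopsOf] at h ⊢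
  refine ⟨hx, fun hcl => h.2 ?_⟩
  exact M.closure_subset_closure (Finset.coe_subset.2 (Finset.erase_subset_erase x hB')) hcl

/-- Lemma 21.1 (coloop form): in a simple matroid a rank-`4` set with at least `5` points has at most two coloops
in its restriction — three coloops would leave a rank-`1` set with two distinct points. -/
theorem mTr_le_two_of_five_le (hs : Simple M) {B : Finset α} (hB : B ⊆ gr M) (hr : M.eRk (B : Set α) = 4)
    (h5 : 5 ≤ B.card) : mTr M B ≤ 2 := by
  unfold mTr
  by_contra hlt
  have hlt : 2 < (coloopsOf M B).card := Nat.lt_of_not_le hlt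
  obtain ⟨a, b, c, ha, hb, hc, hab, hac, hbc⟩ := Finset.two_lt_card_iff.1 hlt
  have haB : a ∈ B := (mem_coloopsOf.1 ha).1
  have hbB : b ∈ B := (mem_coloopsOf.1 hb).1
  have hcB : c ∈ B := (mem_coloopsOf.1 hc).1
  -- remove `a`
  set B1 := B.erase a with hB1
  have hB1B : B1 ⊆ B := Finset.erase_subset a B
  have hr1 : M.eRk (B1 : Set α) = 3 := by
    have := eRk_erase_add_one_of_notMem_closure hB haB (mem_coloopsOf.1 ha).2
    rw [hr] at this
    have h3 : M.eRk (B1 : Set α) + 1 = (3 : ℕ∞) + 1 := by rw [this]; rfl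
    exact WithTop.add_right_cancel WithTop.one_ne_top h3
  have hbB1 : b ∈ B1 := Finset.mem_erase.2 ⟨hab.symm, hbB⟩
  have hcB1 : c ∈ B1 := Finset.mem_erase.2 ⟨hac.symm, hcB⟩
  -- remove `b`
  set B2 := B1.erase b with hB2
  have hB2B1 : B2 ⊆ B1 := Finset.erase_subset b B1
  have hr2 : M.eRk (B2 : Set α) = 2 := by
    have hb1 := mem_coloopsOf_of_subset hB1B hbB1 hb
    have := eRk_erase_add_one_of_notMem_closure (hB1B.trans hB) hbB1 (mem_coloopsOf.1 hb1).2
    rw [hr1] at this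
    have h2 : M.eRk (B2 : Set α) + 1 = (2 : ℕ∞) + 1 := by rw [this]; rfl
    exact WithTop.add_right_cancel WithTop.one_ne_top h2
  have hcB2 : c ∈ B2 := Finset.mem_erase.2 ⟨hbc.symm, hcB1⟩
  -- remove `c`
  set B3 := B2.erase c with hB3
  have hB3B : B3 ⊆ B := (Finset.erase_subset c B2).trans (hB2B1.trans hB1B)
  have hr3 : M.eRk (B3 : Set α) = 1 := by
    have hc2 := mem_coloopsOf_of_subset (hB2B1.trans hB1B) hcB2 hc
    have := eRk_erase_add_one_of_notMem_closure ((hB2B1.trans hB1B).trans hB) hcB2 (mem_coloopsOf.1 hc2).2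
    rw [hr2] at this
    have h1 : M.eRk (B3 : Set α) + 1 = (1 : ℕ∞) + 1 := by rw [this]; rfl
    exact WithTop.add_right_cancel WithTop.one_ne_top h1
  -- `B3` still has two distinct points, so its rank is at least `2`
  have hcard3 : 2 ≤ B3.card := by
    have h1 : B1.card = B.card - 1 := Finset.card_erase_of_mem haB
    have h2 : B2.card = B1.card - 1 := Finset.card_erase_of_mem hbB1
    have h3 : B3.card = B2.card - 1 := Finset.card_erase_of_mem hcB2
    omega
  obtain ⟨u, hu, v, hv, huv⟩ := Finset.one_lt_card.1 hcard3
  have h2le := two_le_eRk_of_two_mem hs (hB3B.trans hB) hu hv huv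
  rw [hr3] at h2le
  exact absurd h2le (by decide)

/-- The classification: a rank-`4` subset of a simple matroid has `m = 4` (four points) or `m ≤ 2`. -/
theorem mTr_eq_four_or_le_two (hs : Simple M) {B : Finset α} (hB : B ⊆ gr M) (hr : M.eRk (B : Set α) = 4) :
    (B.card = 4 ∧ mTr M B = 4) ∨ (B.card ≠ 4 ∧ mTr M B ≤ 2) := by
  by_cases hc : B.card = 4
  · exact Or.inl ⟨hc, mTr_eq_four_of_card_eq_four hr hc⟩
  · have h4 := four_le_card_of_eRk_eq_four hr
    exact Or.inr ⟨hc, mTr_le_two_of_five_le hs hB hr (by omega)⟩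

/-! ## The four kinds and the summed identity -/

/-- `1 − w_∞(B′)` is `4/5` on the independent `4`-sets, `1/2` on `m = 1`, `2/3` on `m = 2` and `0` otherwise. -/
theorem one_sub_wInf_eq (hs : Simple M) {B : Finset α} (hB : B ⊆ gr M) (hr : M.eRk (B : Set α) = 4) :
    1 - wInf M B = (if B.card = 4 then (4 / 5 : ℚ) else 0) + (if mTr M B = 1 then (1 / 2 : ℚ) else 0) +
      (if mTr M B = 2 then (2 / 3 : ℚ) else 0) := by
  unfold wInf
  rcases mTr_eq_four_or_le_two hs hB hr with ⟨hc, hm⟩ | ⟨hc, hm⟩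
  · rw [hm]
    simp only [hc, if_true]
    norm_num
  · simp only [hc, if_false]
    have : mTr M B = 0 ∨ mTr M B = 1 ∨ mTr M B = 2 := by omega
    rcases this with h0 | h1 | h2
    · rw [h0]; norm_num
    · rw [h1]; norm_num
    · rw [h2]; norm_num

/-- `Σ_{B′ ∈ R₄(G)} w_∞(B′) = N₄ − (4/5)·I₄ − (1/2)·pp − (2/3)·lpp` (the content of mine-2 §21.8's
«`1 − w_∞ = 4/5, 1/2, 2/3, 0` on the four kinds of sets»). -/
theorem sum_wInf_eq (hs : Simple M) {G : Finset α} (hG : G ⊆ gr M) :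
    ∑ B ∈ R4 M G, wInf M B =
      (N4 M G : ℚ) - (4 / 5 : ℚ) * (I4 M G : ℚ) - (1 / 2 : ℚ) * (pp M G : ℚ) - (2 / 3 : ℚ) * (lpp M G : ℚ) := by
  have hsum : ∑ B ∈ R4 M G, (1 - wInf M B) =
      ∑ B ∈ R4 M G, ((if B.card = 4 then (4 / 5 : ℚ) else 0) + (if mTr M B = 1 then (1 / 2 : ℚ) else 0) +
        (if mTr M B = 2 then (2 / 3 : ℚ) else 0)) := by
    refine Finset.sum_congr rfl (fun B hB => ?_)
    obtain ⟨hBG, hr⟩ := mem_R4.1 hB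
    exact one_sub_wInf_eq hs (hBG.trans hG) hr
  rw [Finset.sum_sub_distrib, Finset.sum_const, nsmul_eq_mul, mul_one] at hsum
  rw [Finset.sum_add_distrib, Finset.sum_add_distrib, ← Finset.sum_filter, ← Finset.sum_filter,
    ← Finset.sum_filter, Finset.sum_const, Finset.sum_const, Finset.sum_const, nsmul_eq_mul, nsmul_eq_mul,
    nsmul_eq_mul] at hsum
  unfold N4 I4 pp lpp
  linarith

/-! ## The exact identities for `J_t` -/

/-- `J_t = (6 − t)·(N₄ − (4/5)I₄ − (1/2)pp − (2/3)lpp) − (6/5)(N₄ − DF_t)`. -/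
theorem J_eq (hs : Simple M) {G : Finset α} (hG : G ⊆ gr M) (t : ℕ) :
    J M G t = ((6 : ℚ) - t) * ((N4 M G : ℚ) - (4 / 5 : ℚ) * (I4 M G : ℚ) - (1 / 2 : ℚ) * (pp M G : ℚ) -
      (2 / 3 : ℚ) * (lpp M G : ℚ)) - (6 / 5 : ℚ) * ((N4 M G : ℚ) - (DF M G t : ℚ)) := by
  unfold J
  rw [← Finset.mul_sum, sum_wInf_eq hs hG]

/-- §21.8: `J₄ = (4/5)·N₄ + (6/5)·DF₄ − (8/5)·I₄ − pp − (4/3)·lpp`. -/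
theorem J_four_eq (hs : Simple M) {G : Finset α} (hG : G ⊆ gr M) :
    J M G 4 = (4 / 5 : ℚ) * (N4 M G : ℚ) + (6 / 5 : ℚ) * (DF M G 4 : ℚ) - (8 / 5 : ℚ) * (I4 M G : ℚ) -
      (pp M G : ℚ) - (4 / 3 : ℚ) * (lpp M G : ℚ) := by
  rw [J_eq hs hG]
  push_cast
  ring

/-- §21.8: `J₃ = (9/5)·N₄ + (6/5)·DF₃ − (12/5)·I₄ − (3/2)·pp − 2·lpp`. -/
theorem J_three_eq (hs : Simple M) {G : Finset α} (hG : G ⊆ gr M) :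
    J M G 3 = (9 / 5 : ℚ) * (N4 M G : ℚ) + (6 / 5 : ℚ) * (DF M G 3 : ℚ) - (12 / 5 : ℚ) * (I4 M G : ℚ) -
      (3 / 2 : ℚ) * (pp M G : ℚ) - 2 * (lpp M G : ℚ) := by
  rw [J_eq hs hG]
  push_cast
  ring

/-- §21.8: `J₂ = (14/5)·N₄ + (6/5)·DF₂ − (16/5)·I₄ − 2·pp − (8/3)·lpp`. -/
theorem J_two_eq (hs : Simple M) {G : Finset α} (hG : G ⊆ gr M) :
    J M G 2 = (14 / 5 : ℚ) * (N4 M G : ℚ) + (6 / 5 : ℚ) * (DF M G 2 : ℚ) - (16 / 5 : ℚ) * (I4 M G : ℚ) -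
      2 * (pp M G : ℚ) - (8 / 3 : ℚ) * (lpp M G : ℚ) := by
  rw [J_eq hs hG]
  push_cast
  ring

end PercRepro.SixFour
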